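import Summits.HodgeConjecture.HodgeConjecture.Theses.LinearSystemTorelli
import Literature.AlgebraicGeometry.HodgeTheory.MiddleDimensionReductionOfHodgeModels
import Literature.AlgebraicGeometry.HodgeTheory.MiddleDimensionReductionHolds
import Literature.AlgebraicGeometry.HodgeTheory.HypersurfaceSectionLefschetz
import Literature.AlgebraicGeometry.HodgeTheory.SupportedClassesHodgeConiveau
import Literature.AlgebraicGeometry.HodgeTheory.AlgebraicClassesCup
import Literature.AlgebraicGeometry.HodgeTheory.AmbientClassesMoving
import Literature.AlgebraicGeometry.HodgeTheory.HypersurfaceLefschetzUpper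
import Literature.AlgebraicGeometry.HodgeTheory.GysinBaseChange
import Literature.AlgebraicGeometry.HodgeTheory.ComplexGysinRational
import Literature.AlgebraicGeometry.HodgeTheory.RationalClassesRingChange
import Literature.AlgebraicGeometry.HodgeTheory.GysinHodgeClassLiftProofs
import Literature.AlgebraicGeometry.Motives.UniversalHyperplaneSection
import Literature.AlgebraicGeometry.Motives.ProjectiveSpaceFieldPointsBijective
import Literature.AlgebraicGeometry.Motives.ComplexPointsOpenDense
import Literature.AlgebraicGeometry.Motives.VarietiesGeometricallyIntegralProofs
import Literature.Topology.FourManifolds.ComplexProjectiveSpaceHomologyProofs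
import Summits.HodgeConjecture.HodgeConjecture.Theorems.PadicSemiregularLiftHodgeBeyondAnchorsProductsNotAnchors
import Summits.HodgeConjecture.HodgeConjecture.Theorems.LinearSystemTorelliPencilReductionHodgeTypes

/-!
# Route LinearSystemTorelli — `PencilReduction` (item stmt-HodgeConjecture-1083): the correction class is algebraic

Helper file of the conditional assembly `LinearSystemTorelliPencilReduction`. In the incidence situation
`emb : 𝒴 ↪ X × P` (`P = (ℙᴺ)^*`, `N = N' + 1`, `emb^*` bijective on `H²ᵖ` — weak Lefschetz), for an
algebraic class `ζ ∈ Nᵖ H²ᵖ(𝒴(ℂ))` with lift `ζ̃` (`emb^* ζ̃ = ζ`), a rational `(p, p)`-class `c` on `X`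
and any `θ ∈ H^{2N'}(P(ℂ))`, the correction class

  `A₁ = pr_{1*}(pr₂^* θ ∪ (ζ̃ − pr₁^* c)) ∈ H^{2(p-1)}(X(ℂ); ℂ)`

is algebraic, GRANTED the Hodge conjecture in codimension `p − 1` on `X` (hypothesis (ii) of the item)
and Grothendieck's `Nᵖ H²ᵖ ⊆ H^{p,p}` (the tree's named fact
`Grothendieck1969_supportedClasses_le_hodgeConiveau`): `ζ` is a complex combination of RATIONAL algebraic
classes (`supportedClasses_le_span_isRationalClass`), of type `(p, p)`; their lifts are rational
(rational descent along the injective `emb^*`) and of type `(p, p)` (an injective pull-back reflects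
Hodge types); `θ` is a multiple of a rational algebraic class of `P`; cup products, pull-backs and Gysin
images preserve rationality (up to the orientation scalar) and shift Hodge types as they should — so
`A₁` is a complex combination of rational `(p−1, p−1)`-classes. Everything is proved.
-/

noncomputable section

open scoped Manifold ContDiff
open CategoryTheory CategoryTheory.Limits AlgebraicGeometry MonoidalCategory CartesianMonoidalCategory
open Literature.AlgebraicTopology.SingularHomology
open Literature.AlgebraicGeometry Literature.AlgebraicGeometry.Motives Literature.AlgebraicGeometry.HodgeTheory

set_option linter.dupNamespace false

namespace Summit.HodgeConjecture.HodgeConjecture.Theorems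

/-- **The correction class `A₁ = pr_{1*}(pr₂^* θ ∪ (ζ̃ − pr₁^* c))` is algebraic**, granted the Hodge
conjecture in codimension `p − 1` on `X` and Grothendieck's Hodge-coniveau inclusion (module docstring).
[cite: VoisinHodgeI2002, §7.1.1, §7.3.2 and Prop. 11.20] [cite: GrothendieckTopology1969, pp. 299–300] -/
theorem correction_mem_algebraicClasses (hG : Grothendieck1969_supportedClasses_le_hodgeConiveau)
    (μ : OrientationFamily) {m p N N' : ℕ} (hN' : N = N' + 1) (hp : 1 ≤ p)
    {X Y : SchemeOver ℂ} (hX : IsSmoothProjective (m + 1) X)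
    (hP : IsSmoothProjective N (dualProjectiveSpace N ℂ))
    (hXP : IsSmoothProjective (m + 1 + N) (X ⊗ dualProjectiveSpace N ℂ))
    (hY : IsSmoothProjective (m + N) Y) (emb : Y ⟶ X ⊗ dualProjectiveSpace N ℂ)
    (H2 : ∀ c : complexBetti X (2 * (p - 1)), IsRationalClass c →
      IsOfHodgeType (m + 1) X (2 * (p - 1)) (p - 1) (p - 1) c → c ∈ algebraicClasses X (p - 1))
    (θ : complexBetti (dualProjectiveSpace N ℂ) (2 * N'))
    {ζ : complexBetti Y (2 * p)} (hζ : ζ ∈ algebraicClasses Y p)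
    (hbij : Function.Bijective (complexBetti.map emb (2 * p)))
    {ζt : complexBetti (X ⊗ dualProjectiveSpace N ℂ) (2 * p)} (hζt : complexBetti.map emb (2 * p) ζt = ζ)
    {c : complexBetti X (2 * p)} (hc : IsRationalClass c) (hh : IsOfHodgeType (m + 1) X (2 * p) p p c) :
    complexGysin μ hXP hX (fst X (dualProjectiveSpace N ℂ))
      (show (2 * N' + 2 * p) + 2 * (m + 1) = 2 * (p - 1) + 2 * (m + 1 + N) by omega)
      (cupProduct rfl (complexBetti.map (snd X (dualProjectiveSpace N ℂ)) (2 * N') θ)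
        (ζt - complexBetti.map (fst X (dualProjectiveSpace N ℂ)) (2 * p) c)) ∈ algebraicClasses X (p - 1) := by
  -- standing discharges of the tree
  have hI : hodgePQ_independent_of_hodgeModel := hodgePQ_independent_of_hodgeModel_holds
  have hA : ∀ ⦃n : ℕ⦄ ⦃Y : SchemeOver ℂ⦄, nonempty_hodgeModel n Y := fun _ _ ↦ nonempty_hodgeModel_holds
  have hdR : ∀ (E : Type) [NormedAddCommGroup E] [NormedSpace ℂ E] [FiniteDimensional ℂ E],
      Literature.NumberTheory.Transcendental.exists_deRhamIsoFamily 𝓘(ℝ, E) :=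
    fun E _ _ _ ↦ Literature.NumberTheory.Transcendental.exists_deRhamIsoFamily_holds E
  set Θ : complexBetti (X ⊗ dualProjectiveSpace N ℂ) (2 * N') :=
    complexBetti.map (snd X (dualProjectiveSpace N ℂ)) (2 * N') θ with hΘdef
  set A₁ : complexBetti X (2 * (p - 1)) := complexGysin μ hXP hX (fst X (dualProjectiveSpace N ℂ))
    (show (2 * N' + 2 * p) + 2 * (m + 1) = 2 * (p - 1) + 2 * (m + 1 + N) by omega)
    (cupProduct rfl Θ (ζt - complexBetti.map (fst X (dualProjectiveSpace N ℂ)) (2 * p) c)) with hA₁def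
  have hAdeg : (2 * N' + 2 * p) + 2 * (m + 1) = 2 * (p - 1) + 2 * (m + 1 + N) := by omega
  let Φ : complexBetti (X ⊗ (dualProjectiveSpace N ℂ)) (2 * p) →ₗ[ℂ] complexBetti X (2 * (p - 1)) :=
    complexGysin μ hXP hX (fst X (dualProjectiveSpace N ℂ)) hAdeg ∘ₗ cupProduct rfl Θ
  obtain ⟨AP⟩ := (hA (Y := X ⊗ (dualProjectiveSpace N ℂ))).nonempty hXP
  obtain ⟨AY⟩ := (hA (Y := Y)).nonempty hY
  obtain ⟨APP⟩ := (hA (Y := (dualProjectiveSpace N ℂ))).nonempty hP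
  -- `θ = μ₀ • θr` with `θr` rational, algebraic on `(dualProjectiveSpace N ℂ)`, hence of type `(N', N')`
  obtain ⟨θr, hθr, hθr0⟩ : ∃ θr : complexBetti (dualProjectiveSpace N ℂ) (2 * N'), IsRationalClass θr ∧ θr ≠ 0 := by
    have h1 : Module.finrank ℂ (complexBetti (dualProjectiveSpace N ℂ) (2 * N')) = 1 :=
      finrank_complexBetti_projectiveSpace_two_mul N (k := N') (by omega)
    by_contra h
    have h' : ∀ c : complexBetti (dualProjectiveSpace N ℂ) (2 * N'), IsRationalClass c → c = 0 :=
      fun c hc ↦ by_contra fun hne ↦ h ⟨c, hc, hne⟩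
    have hbot : Submodule.span ℂ {c : complexBetti (dualProjectiveSpace N ℂ) (2 * N') | IsRationalClass c} = ⊥ :=
      Submodule.span_eq_bot.2 fun c hc ↦ h' c hc
    have htop := span_isRationalClass_eq_top_of_isSmoothProjective_holds N (dualProjectiveSpace N ℂ) hP (2 * N')
    rw [hbot] at htop
    haveI : Nontrivial (complexBetti (dualProjectiveSpace N ℂ) (2 * N')) := Module.nontrivial_of_finrank_eq_succ h1
    exact bot_ne_top htop
  obtain ⟨μ₀, hμ₀⟩ : ∃ μ₀ : ℂ, μ₀ • θr = θ :=
    (finrank_eq_one_iff_of_nonzero' θr hθr0).1 (finrank_complexBetti_projectiveSpace_two_mul N (k := N') (by omega)) θ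
  have hθralg : θr ∈ algebraicClasses (dualProjectiveSpace N ℂ) N' := by
    have h := map_projectiveSpace_mem_iSup_ker_restrictCompl hP (𝟙 (dualProjectiveSpace N ℂ)) isClosed_univ (k := 0) (l := N')
      (fun w _ ↦ by simp) θr
    rw [complexBetti.map_id, CategoryTheory.id_apply] at h
    refine (iSup_le fun T ↦ iSup_le fun hT ↦ iSup_le fun hcond ↦ ?_ :
      (⨆ (T : Set (dualProjectiveSpace N ℂ).left) (_ : IsClosed T) (_ : ∀ t ∈ T ∩ Set.univ, ((N' + 0 : ℕ) : ℕ∞) ≤ Order.coheight t),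
        LinearMap.ker (complexBetti.restrictCompl (dualProjectiveSpace N ℂ) T (2 * N')).hom) ≤ algebraicClasses (dualProjectiveSpace N ℂ) N') h
    intro x hx
    exact mem_supportedClasses_of_restrictCompl_eq_zero hT
      (fun t ht ↦ by simpa using hcond t ⟨ht, Set.mem_univ t⟩) (LinearMap.mem_ker.1 hx)
  have hθrtyp : IsOfHodgeType N (dualProjectiveSpace N ℂ) (2 * N') N' N' θr := isOfHodgeType_of_mem_algebraicClasses hG hP APP hθralg
  -- `Φ x` is algebraic for `x` rational of type `(p, p)` (hypothesis (ii))
  have hΦ : ∀ x : complexBetti (X ⊗ (dualProjectiveSpace N ℂ)) (2 * p), IsRationalClass x →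
      IsOfHodgeType (m + 1 + N) (X ⊗ (dualProjectiveSpace N ℂ)) (2 * p) p p x → Φ x ∈ algebraicClasses X (p - 1) := by
    intro x hxr hxt
    obtain ⟨u, hu0, hu⟩ := exists_smul_isRationalClass_complexGysin μ hXP hX (fst X (dualProjectiveSpace N ℂ)) hAdeg
    have hcupr : IsRationalClass (cupProduct rfl (complexBetti.map (snd X (dualProjectiveSpace N ℂ)) (2 * N') θr) x) :=
      (hθr.map _).cup _ hxr
    have hcupt : IsOfHodgeType (m + 1 + N) (X ⊗ (dualProjectiveSpace N ℂ)) (2 * N' + 2 * p) (N' + p) (N' + p)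
        (cupProduct rfl (complexBetti.map (snd X (dualProjectiveSpace N ℂ)) (2 * N') θr) x) :=
      cupPreservesHodgeType_of_nonempty_hodgeModel hI (@hA _ _) hdR hXP rfl
        (preservesHodgeType_of_nonempty_hodgeModel hI (@hA _ _) hXP hP (snd X (dualProjectiveSpace N ℂ)) hθrtyp) hxt
    obtain ⟨r, hr, hur⟩ := hu _ hcupr
    have hrt : IsOfHodgeType (m + 1) X (2 * (p - 1)) (p - 1) (p - 1) r := by
      have h1 := isOfHodgeType_complexGysin hI (fun _ _ ↦ @hA _ _) hdR μ hXP hX (fst X (dualProjectiveSpace N ℂ)) hAdeg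
        (p := N' + p) (q := N' + p) (p' := p - 1) (q' := p - 1) (by omega) (by omega) hcupt
      rw [hur] at h1
      obtain ⟨A', hA'⟩ := h1
      refine ⟨A', ?_⟩
      rw [map_smul] at hA'
      exact (Submodule.smul_mem_iff _ hu0).1 hA'
    have hralg : r ∈ algebraicClasses X (p - 1) := H2 r hr hrt
    have hΦx : Φ x = (μ₀ * u) • r := by
      change complexGysin μ hXP hX (fst X (dualProjectiveSpace N ℂ)) hAdeg (cupProduct rfl Θ x) = _
      rw [hΘdef, ← hμ₀, map_smul, map_smul (cupProduct rfl), LinearMap.smul_apply, map_smul, hur, smul_smul]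
    rw [hΦx]
    exact Submodule.smul_mem _ _ hralg
  -- `pr₁^* c` is rational of type `(p, p)`
  have hgood_c : Φ (complexBetti.map (fst X (dualProjectiveSpace N ℂ)) (2 * p) c) ∈ algebraicClasses X (p - 1) :=
    hΦ _ (hc.map _) (preservesHodgeType_of_nonempty_hodgeModel hI (@hA _ _) hXP hX (fst X (dualProjectiveSpace N ℂ)) hh)
  -- `ζt` lies in the span of lifts of rational algebraic classes on `Y`, rational of type `(p, p)`
  have hgood_ζ : Φ ζt ∈ algebraicClasses X (p - 1) := by
    have hspan := supportedClasses_le_span_isRationalClass hY (2 * p) p hζ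
    let Tsub : Submodule ℂ (complexBetti (X ⊗ (dualProjectiveSpace N ℂ)) (2 * p)) := (algebraicClasses X (p - 1)).comap Φ
    have hle : Submodule.span ℂ {c' : complexBetti Y (2 * p) | IsRationalClass c' ∧ c' ∈ supportedClasses Y (2 * p) p} ≤
        Tsub.map (complexBetti.map emb (2 * p)).hom := by
      refine Submodule.span_le.2 ?_
      rintro ζ' ⟨hζ'r, hζ'a⟩
      obtain ⟨x', hx'⟩ := hbij.2 ζ'
      refine ⟨x', ?_, hx'⟩
      have hx'r : IsRationalClass x' :=
        IsRationalClass.of_apply_of_injective' hXP (complexBetti.map emb (2 * p)).hom hbij.1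
          (fun c hc ↦ hc.map _) (by rw [show (complexBetti.map emb (2 * p)).hom x' = ζ' from hx']; exact hζ'r)
      have hx't : IsOfHodgeType (m + 1 + N) (X ⊗ (dualProjectiveSpace N ℂ)) (2 * p) p p x' :=
        IsOfHodgeType.of_map_of_injective hI hY hXP AY AP emb hbij.1
          (by rw [show complexBetti.map emb (2 * p) x' = ζ' from hx']
              exact isOfHodgeType_of_mem_algebraicClasses hG hY AY hζ'a)
      exact hΦ x' hx'r hx't
    obtain ⟨x, hxT, hxζ⟩ := Submodule.mem_map.1 (hle hspan)
    have hxeq : x = ζt := hbij.1 (hxζ.trans hζt.symm)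
    rw [← hxeq]
    exact hxT
  have hA₁Φ : A₁ = Φ ζt - Φ (complexBetti.map (fst X (dualProjectiveSpace N ℂ)) (2 * p) c) := by
    rw [← map_sub]
    rfl
  rw [hA₁Φ]
  exact Submodule.sub_mem _ hgood_ζ hgood_c

end Summit.HodgeConjecture.HodgeConjecture.Theorems

end
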